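import Summits.NavierStokesRegularity.NavierStokesRegularity.Theses.TypeICertificateLadder
import Literature.Analysis.FluidPDE.TypeIAncientMildClassical
import Literature.Analysis.FluidPDE.AncientSimilarityVariables
import Literature.Analysis.FluidPDE.PineauVicolGaussSobolev

/-!
# Candidate proof of S3 `stub_headFluxCriterion` (line `head-flux-channel`, crux stmt-NavierStokesRegularity-1217)

refuter-drefute-stmt-NavierStokesRegularity-1217-0, 2026-08-16 — CANDIDATE EVIDENCE for the lead / a prover to land
(`--supports stmt-NavierStokesRegularity-1217`); the refuter does not land positive statements.

`headFluxCriterion` below has EXACTLY the type of the skeleton's `stub_headFluxCriterion`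
(`Cruxes/Target/Lines/head-flux-channel.lean`). The analytic core is the abstract backward window
Grönwall lemma `energy_vanishes_of_window_law`: for real functions `E, D, Ch` with `0 ≤ E ≤ M`,
`0 ≤ D`, `D, Ch` continuous, `E' = -D - E - ½Ch` and the window law
`∫ₐᵇ(-½Ch) ≤ (1-ε)∫ₐᵇ(D+E)` (`a + S₀ ≤ b`), one has `E ≡ 0`: by FTC `ε∫ₐᵇ(D+E) ≤ E(a) - E(b) ≤ M`
on windows, so `E(b) ≤ E(a)` and `E` takes values `< η` below every `A` (else `η·length ≤ M/ε` on
long windows), whence `E(b) < η` for all `η > 0`. Then `E(s) = ∫ ½‖U(s,·)‖²γ = 0` with a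
continuous nonnegative integrable integrand forces `U(s,·) ≡ 0`, and `u ≡ 0` on `t < 0` by
`eq_lerayOrbit_of_neg`.
-/

noncomputable section

namespace Summit.NavierStokesRegularity.NavierStokesRegularity.Theorems.HeadFluxChannelS3

open MeasureTheory Set Filter Topology Function
open scoped RealInnerProductSpace ContDiff
open Literature.Analysis.FluidPDE
open Literature.Analysis.FluidPDE.PineauVicol2026

local notation "ℝ³" => EuclideanSpace ℝ (Fin 3)

set_option linter.dupNamespace false

/-- **Backward window Grönwall.** If `0 ≤ E ≤ M`, `0 ≤ D`, `D` and `Ch` are continuous,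
`E' = -D - E - ½Ch` everywhere and the window law `∫ₐᵇ(-½Ch) ≤ (1-ε)∫ₐᵇ(D+E)` holds whenever
`a + S₀ ≤ b`, for some `ε > 0`, then `E ≡ 0`. [folklore] -/
theorem energy_vanishes_of_window_law {E D Ch : ℝ → ℝ} {M ε S₀ : ℝ}
    (hE0 : ∀ s, 0 ≤ E s) (hEM : ∀ s, E s ≤ M) (hD0 : ∀ s, 0 ≤ D s)
    (hDc : Continuous D) (hChc : Continuous Ch)
    (hderiv : ∀ s, HasDerivAt E (-(D s) - E s - Ch s / 2) s) (hε : 0 < ε)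
    (hlaw : ∀ a b : ℝ, a + S₀ ≤ b →
      (∫ s in a..b, -(Ch s) / 2) ≤ (1 - ε) * ∫ s in a..b, (D s + E s)) :
    ∀ s, E s = 0 := by
  have hEc : Continuous E := continuous_iff_continuousAt.2 fun s => (hderiv s).continuousAt
  have hFc : Continuous fun s => D s + E s := hDc.add hEc
  have hM : 0 ≤ M := (hE0 0).trans (hEM 0)
  -- FTC on a window
  have key : ∀ a b : ℝ, a + S₀ ≤ b → ε * ∫ s in a..b, (D s + E s) ≤ E a - E b := by
    intro a b hab
    have hftc : ∫ s in a..b, (-(D s) - E s - Ch s / 2) = E b - E a :=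
      intervalIntegral.integral_eq_sub_of_hasDerivAt (fun s _ => hderiv s)
        ((show Continuous fun s => -(D s) - E s - Ch s / 2 by fun_prop).intervalIntegrable a b)
    have hc1 : Continuous fun s => -(Ch s) / 2 := by fun_prop
    have hsplit : ∫ s in a..b, (-(D s) - E s - Ch s / 2) =
        (∫ s in a..b, -(Ch s) / 2) - ∫ s in a..b, (D s + E s) := by
      rw [← intervalIntegral.integral_sub (hc1.intervalIntegrable a b)
        (hFc.intervalIntegrable a b)]
      refine intervalIntegral.integral_congr fun s _ => ?_
      ring
    have hl := hlaw a b hab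
    rw [hsplit] at hftc
    nlinarith [hftc, hl]
  -- monotonicity along admissible windows
  have hmono : ∀ a b : ℝ, a + S₀ ≤ b → a ≤ b → E b ≤ E a := by
    intro a b hab hab'
    have h0 : 0 ≤ ∫ s in a..b, (D s + E s) :=
      intervalIntegral.integral_nonneg hab' fun s _ => add_nonneg (hD0 s) (hE0 s)
    have := key a b hab
    nlinarith [mul_nonneg hε.le h0]
  -- `E` gets small arbitrarily far in the past
  have hsmall : ∀ η : ℝ, 0 < η → ∀ A : ℝ, ∃ a, a ≤ A ∧ E a < η := by
    intro η hη A
    by_contra hcon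
    push Not at hcon
    have hεη : 0 < ε * η := mul_pos hε hη
    set S₁ : ℝ := max S₀ 0 with hS₁
    set L : ℝ := M / (ε * η) + 1 with hL
    set a : ℝ := A - S₁ - L with ha
    have hS₁0 : 0 ≤ S₁ := le_max_right _ _
    have hS₀S₁ : S₀ ≤ S₁ := le_max_left _ _
    have hL0 : 0 < L := by positivity
    have hab : a + S₀ ≤ A := by rw [ha]; linarith
    have hab' : a ≤ A := by rw [ha]; linarith
    have hlow : η * (A - a) ≤ ∫ s in a..A, (D s + E s) := by
      have h1 : ∫ _ in a..A, η = (A - a) * η := by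
        rw [intervalIntegral.integral_const, smul_eq_mul]
      have h2 : (∫ _ in a..A, η) ≤ ∫ s in a..A, (D s + E s) :=
        intervalIntegral.integral_mono_on hab' (continuous_const.intervalIntegrable a A)
          (hFc.intervalIntegrable a A)
          fun s hs => (hcon s hs.2).trans (le_add_of_nonneg_left (hD0 s))
      nlinarith [h1, h2]
    have hup : ε * ∫ s in a..A, (D s + E s) ≤ M :=
      (key a A hab).trans (by linarith [hEM a, hE0 A])
    have hAa : A - a = S₁ + L := by rw [ha]; ring
    have hEL : ε * η * L = M + ε * η := by
      rw [hL]; field_simp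
    have h3 : ε * (η * (A - a)) ≤ M := (mul_le_mul_of_nonneg_left hlow hε.le).trans hup
    rw [hAa] at h3
    nlinarith [mul_nonneg hεη.le hS₁0]
  -- conclusion
  intro s
  refine le_antisymm ?_ (hE0 s)
  by_contra hpos
  push Not at hpos
  obtain ⟨a, ha, hEa⟩ := hsmall (E s) hpos (s - max S₀ 0)
  have h1 : a + S₀ ≤ s := by linarith [le_max_left S₀ 0]
  have h2 : a ≤ s := by linarith [le_max_right S₀ 0]
  exact absurd (hmono a s h1 h2) (not_le.2 hEa)

/-- The similarity profile of a Type-I ancient mild field is bounded by its constant: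
`‖U(s,y)‖ ≤ C`. [folklore] -/
theorem norm_lerayOrbit_le {C : ℝ} {u : ℝ → ℝ³ → ℝ³} (hA : IsTypeIAncientMild C u) (s : ℝ) (y : ℝ³) :
    ‖lerayOrbit u s y‖ ≤ C := by
  have ht : -Real.exp (-s) < 0 := neg_neg_of_pos (Real.exp_pos _)
  have hpos : 0 < Real.exp (-s / 2) := Real.exp_pos _
  have key := hA.norm_le ht (Real.exp (-s / 2) • y)
  rw [neg_neg, sqrt_exp_neg] at key
  rw [lerayOrbit_apply, norm_smul, Real.norm_of_nonneg hpos.le]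
  calc Real.exp (-s / 2) * ‖u (-Real.exp (-s)) (Real.exp (-s / 2) • y)‖
      ≤ Real.exp (-s / 2) * (C / Real.exp (-s / 2)) := by gcongr
    _ = C := by field_simp

/-- Slices of the similarity profile are continuous. [folklore] -/
theorem continuous_lerayOrbit_slice {C : ℝ} {u : ℝ → ℝ³ → ℝ³} (hA : IsTypeIAncientMild C u) (s : ℝ) :
    Continuous (lerayOrbit u s) := by
  have hc : Continuous (uncurry (lerayOrbit u)) := (contDiff_uncurry_lerayOrbit hA.contDiffOn).continuous
  exact hc.comp (continuous_const.prodMk continuous_id)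

/-- **S3 — the head-flux criterion** (exact type of the skeleton's `stub_headFluxCriterion`). -/
theorem headFluxCriterion :
    ∀ (C : ℝ) (u : ℝ → EuclideanSpace ℝ (Fin 3) → EuclideanSpace ℝ (Fin 3))
      (p : ℝ → EuclideanSpace ℝ (Fin 3) → ℝ),
      IsTypeIAncientMild C u →
      Continuous (fun s : ℝ =>
          ∫ y, frobeniusNormSq (fderiv ℝ (lerayOrbit u s) y) * Real.exp (-‖y‖ ^ 2 / 4)) →
      Continuous (fun s : ℝ =>
          ∫ y, (‖lerayOrbit u s y‖ ^ 2 / 2 + lerayOrbitPressure p s y) *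
            ⟪y, lerayOrbit u s y⟫ * Real.exp (-‖y‖ ^ 2 / 4)) →
      (∀ s : ℝ,
        HasDerivAt (fun σ : ℝ => ∫ y, ‖lerayOrbit u σ y‖ ^ 2 / 2 * Real.exp (-‖y‖ ^ 2 / 4))
          (-(∫ y, frobeniusNormSq (fderiv ℝ (lerayOrbit u s) y) * Real.exp (-‖y‖ ^ 2 / 4))
            - (∫ y, ‖lerayOrbit u s y‖ ^ 2 / 2 * Real.exp (-‖y‖ ^ 2 / 4))
            - (∫ y, (‖lerayOrbit u s y‖ ^ 2 / 2 + lerayOrbitPressure p s y) *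
                ⟪y, lerayOrbit u s y⟫ * Real.exp (-‖y‖ ^ 2 / 4)) / 2) s) →
      (∃ ε : ℝ, 0 < ε ∧ ∃ S₀ : ℝ, ∀ a b : ℝ, a + S₀ ≤ b →
        (∫ s in a..b, -(∫ y, (‖lerayOrbit u s y‖ ^ 2 / 2 + lerayOrbitPressure p s y) *
            ⟪y, lerayOrbit u s y⟫ * Real.exp (-‖y‖ ^ 2 / 4)) / 2) ≤
          (1 - ε) * ∫ s in a..b,
            ((∫ y, frobeniusNormSq (fderiv ℝ (lerayOrbit u s) y) * Real.exp (-‖y‖ ^ 2 / 4)) +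
              ∫ y, ‖lerayOrbit u s y‖ ^ 2 / 2 * Real.exp (-‖y‖ ^ 2 / 4))) →
      ∀ t < 0, ∀ x, u t x = 0 := by
  intro C u p hA hDc hChc hE hlaw
  obtain ⟨ε, hε, S₀, hlaw⟩ := hlaw
  have hU := norm_lerayOrbit_le hA
  have hUc := continuous_lerayOrbit_slice hA
  -- the energy integrand: continuous, nonnegative, dominated by `C²/2 · γ`
  have hIc : ∀ s, Continuous fun y : ℝ³ => ‖lerayOrbit u s y‖ ^ 2 / 2 * Real.exp (-‖y‖ ^ 2 / 4) :=
    fun s => (((hUc s).norm.pow 2).div_const 2).mul continuous_gaussWeight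
  have hIle : ∀ s (y : ℝ³), ‖lerayOrbit u s y‖ ^ 2 / 2 * Real.exp (-‖y‖ ^ 2 / 4) ≤
      C ^ 2 / 2 * gaussWeight y := fun s y =>
    mul_le_mul_of_nonneg_right
      (div_le_div_of_nonneg_right (pow_le_pow_left₀ (norm_nonneg _) (hU s y) 2) (by norm_num))
      (gaussWeight_pos y).le
  have hInn : ∀ s (y : ℝ³), 0 ≤ ‖lerayOrbit u s y‖ ^ 2 / 2 * Real.exp (-‖y‖ ^ 2 / 4) :=
    fun s y => mul_nonneg (by positivity) (Real.exp_pos _).le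
  have hint : ∀ s, Integrable fun y : ℝ³ => ‖lerayOrbit u s y‖ ^ 2 / 2 * Real.exp (-‖y‖ ^ 2 / 4) :=
    fun s => (integrable_gaussWeight.const_mul (C ^ 2 / 2)).mono' (hIc s).aestronglyMeasurable
      (Eventually.of_forall fun y => by
        rw [Real.norm_of_nonneg (hInn s y)]
        exact hIle s y)
  have hE0 : ∀ s, 0 ≤ ∫ y : ℝ³, ‖lerayOrbit u s y‖ ^ 2 / 2 * Real.exp (-‖y‖ ^ 2 / 4) :=
    fun s => integral_nonneg (hInn s)
  have hEM : ∀ s, (∫ y : ℝ³, ‖lerayOrbit u s y‖ ^ 2 / 2 * Real.exp (-‖y‖ ^ 2 / 4)) ≤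
      C ^ 2 / 2 * ∫ y : ℝ³, gaussWeight y := fun s => by
    rw [← integral_const_mul]
    exact integral_mono (hint s) (integrable_gaussWeight.const_mul _) (hIle s)
  have hD0 : ∀ s, 0 ≤ ∫ y : ℝ³, frobeniusNormSq (fderiv ℝ (lerayOrbit u s) y) * Real.exp (-‖y‖ ^ 2 / 4) :=
    fun s => integral_nonneg fun y => mul_nonneg (frobeniusNormSq_nonneg _) (Real.exp_pos _).le
  have hzero := energy_vanishes_of_window_law
    (E := fun σ : ℝ => ∫ y, ‖lerayOrbit u σ y‖ ^ 2 / 2 * Real.exp (-‖y‖ ^ 2 / 4))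
    (D := fun s : ℝ => ∫ y, frobeniusNormSq (fderiv ℝ (lerayOrbit u s) y) * Real.exp (-‖y‖ ^ 2 / 4))
    (Ch := fun s : ℝ => ∫ y, (‖lerayOrbit u s y‖ ^ 2 / 2 + lerayOrbitPressure p s y) *
            ⟪y, lerayOrbit u s y⟫ * Real.exp (-‖y‖ ^ 2 / 4))
    hE0 hEM hD0 hDc hChc hE hε hlaw
  -- `E(s) = 0` forces `U(s, ·) ≡ 0`
  have hUzero : ∀ s (y : ℝ³), lerayOrbit u s y = 0 := by
    intro s y
    have hae := (integral_eq_zero_iff_of_nonneg (fun y => hInn s y) (hint s)).1 (hzero s)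
    have hfun : (fun y : ℝ³ => ‖lerayOrbit u s y‖ ^ 2 / 2 * Real.exp (-‖y‖ ^ 2 / 4)) = fun _ => 0 :=
      ((hIc s).ae_eq_iff_eq volume continuous_const).1 hae
    have hy := congr_fun hfun y
    simp only [mul_eq_zero, (Real.exp_pos _).ne', or_false, div_eq_zero_iff, OfNat.ofNat_ne_zero,
      pow_eq_zero_iff, ne_eq, not_false_eq_true, norm_eq_zero] at hy
    exact hy
  intro t ht x
  rw [eq_lerayOrbit_of_neg u ht x, hUzero, smul_zero]

end Summit.NavierStokesRegularity.NavierStokesRegularity.Theorems.HeadFluxChannelS3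

end
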